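import Literature.NumberTheory.Automorphic.GaloisActionPlaces
import Literature.NumberTheory.DiophantineGeometry.CatalanJacobiSum
import Literature.NumberTheory.LFunctions.RayClassCharacter
import HarnessLib

/-!
# F1 → THE MATCH: the (D-conj) reindexing `Σ ψ̄(𝔟)·F(N𝔟) = Σ ψ(𝔟)·F(N𝔟)` under CM-reality

Summit `BirchSwinnertonDyer`, crux `SmallImageLowerHalfBothSigns` (stmt-23599), line `rtt_w3`, stub S4‴ (LEAD ruling «(F) = (α)», 2026-08-31).
Namespace `…Theorems.SmallImageRttF1Bridge`. THEOREMS ONLY.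

Kato's value law (tree `SmallImageRttF1Bridge.prop159_values_inert_dirichlet_of_isGrossencharakter`) carries the depleted series with coefficients
`ψ̄(𝔟)·χ(N𝔟)` (`conj (idealPow K ψ 𝔟)`), the Mazur–Tate side (`SmallImageRttReciprocity.exists_period_transport_rayClass`) the series with
coefficients `ψ(𝔟)·χ(N𝔟)`. Under CM-REALITY — `ψ(c • w) = \overline{ψ(w)}` for the primes `w ∤ 𝔪`, `c` an automorphism of `K` (complex conjugation) —
and `c`-stability of the depletion modulus `𝔠 ⊆ 𝔪`, the two series agree termwise after the reindexing `𝔟 ↦ c • 𝔟` (Galois-conjugate ideals have the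
same norm and the same coprimality to `𝔠`; `ψ(c • 𝔟) = ∏ ψ(c • w)^{ord_w 𝔟} = \overline{ψ(𝔟)}`):

* `idealPow_smul` — `idealPow ψ (c • 𝔟) = idealPow (ψ ∘ (c • ·)) 𝔟` (`ord_{c w}(c 𝔟) = ord_w 𝔟`, tree `HeightOneSpectrum.count_smul_asIdeal`).
* `idealPow_smul_eq_conj` — with CM-reality off `𝔪` and `𝔟` prime to `𝔪`: `idealPow ψ (c • 𝔟) = \overline{idealPow ψ 𝔟}`.
* `isCoprime_smul_iff` — `(c • 𝔟, 𝔠) = 1 ↔ (𝔟, 𝔠) = 1` when `c • 𝔠 = 𝔠`.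
* ★ `tsum_conj_idealPow_eq_tsum_idealPow` — `Σ'_{(𝔟,𝔠)=1} \overline{ψ(𝔟)}·F(N𝔟) = Σ'_{(𝔟,𝔠)=1} ψ(𝔟)·F(N𝔟)` for ANY `F : ℕ → ℂ` (e.g. `F m = χ(m)·m^{−s}`).

References: [SilvermanATAEC1994] Ch. II Ex. 2.30 (CM-reality of the Grössencharacter); [Kato2004Asterisque] (15.9.1); [NeukirchANT1999] VII §8 (8.1).
-/

-- the Theorems namespace of this sub repeats the summit name by design (D-0017 nested layout)
set_option linter.dupNamespace false

noncomputable section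

open scoped Classical NumberField ComplexConjugate Pointwise
open NumberField IsDedekindDomain

namespace Summit.BirchSwinnertonDyer.BirchSwinnertonDyer.Theorems.SmallImageRttF1Bridge

open Literature.NumberTheory.LFunctions Literature.NumberTheory.Automorphic

variable {K : Type} [Field K] [NumberField K]

/-- **`ψ(c • 𝔟) = ∏_w ψ(c • w)^{ord_w 𝔟}`**: the ideal character at a Galois-conjugate ideal is the ideal character of the conjugated prime values
(reindex the product by `w ↦ c • w`; `ord_{c w}(c 𝔟) = ord_w 𝔟`). [cite: NeukirchANT1999, Ch. VII §8 (8.1) with Ch. I (3.3)] -/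
theorem idealPow_smul (c : K ≃ₐ[ℚ] K) (ψ : HeightOneSpectrum (𝓞 K) → ℂ) {I : Ideal (𝓞 K)} (hI : I ≠ ⊥) :
    idealPow K ψ (c • I) = idealPow K (fun w ↦ ψ (c • w)) I := by
  unfold idealPow
  exact (finprod_eq_of_bijective (fun w : HeightOneSpectrum (𝓞 K) ↦ c • w) (MulAction.bijective c) fun w ↦ by
    rw [HeightOneSpectrum.count_smul_asIdeal c w hI]).symm

/-- Prime values that agree off `𝔪` give the same ideal character on the nonzero ideals prime to `𝔪`.
[cite: NeukirchANT1999, Ch. VII §6, before (6.8)] -/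
theorem idealPow_congr_off {f g : HeightOneSpectrum (𝓞 K) → ℂ} {𝔪 I : Ideal (𝓞 K)}
    (hfg : ∀ v : HeightOneSpectrum (𝓞 K), ¬ 𝔪 ≤ v.asIdeal → f v = g v) (hI : I ≠ ⊥) (hI𝔪 : IsCoprime I 𝔪) :
    idealPow K f I = idealPow K g I := by
  unfold idealPow
  refine finprod_congr fun v ↦ ?_
  by_cases hv : 𝔪 ≤ v.asIdeal
  · have hc : (Associates.mk v.asIdeal).count (Associates.mk I).factors = 0 := by
      by_contra hc
      have hdvd : v.asIdeal ∣ I := (Associates.count_ne_zero_iff_dvd hI v.irreducible).mp hc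
      have hle : I ⊔ 𝔪 ≤ v.asIdeal := sup_le (Ideal.le_of_dvd hdvd) hv
      rw [Ideal.isCoprime_iff_sup_eq.mp hI𝔪, top_le_iff] at hle
      exact v.isPrime.ne_top hle
    rw [hc, pow_zero, pow_zero]
  · rw [hfg v hv]

/-- **CM-reality on ideals**: if `ψ(c • w) = \overline{ψ(w)}` for the primes `w ∤ 𝔪`, then `ψ(c • 𝔟) = \overline{ψ(𝔟)}` for every nonzero `𝔟` prime to `𝔪`.
[cite: SilvermanATAEC1994, Ch. II Ex. 2.30] -/
theorem idealPow_smul_eq_conj (c : K ≃ₐ[ℚ] K) {𝔪 : Ideal (𝓞 K)} {ψ : HeightOneSpectrum (𝓞 K) → ℂ}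
    (hψc : ∀ w : HeightOneSpectrum (𝓞 K), ¬ 𝔪 ≤ w.asIdeal → ψ (c • w) = conj (ψ w)) {I : Ideal (𝓞 K)} (hI : I ≠ ⊥) (hI𝔪 : IsCoprime I 𝔪) :
    idealPow K ψ (c • I) = conj (idealPow K ψ I) := by
  rw [idealPow_smul c ψ hI, idealPow_congr_off hψc hI hI𝔪]
  symm
  unfold idealPow
  rw [map_finprod _ (mulSupport_idealPow_finite ψ hI)]
  exact finprod_congr fun v ↦ by rw [map_pow]

/-- `c • ⊤ = ⊤` for the pointwise action on ideals. [cite: NeukirchANT1999, Ch. I §9 (before (9.1))] -/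
theorem smul_top_ideal (c : K ≃ₐ[ℚ] K) : c • (⊤ : Ideal (𝓞 K)) = ⊤ := by
  rw [Ideal.pointwise_smul_def, Ideal.map_top]

/-- **Coprimality to a `c`-stable modulus is `c`-invariant**: `(c • 𝔟) + 𝔠 = 1 ↔ 𝔟 + 𝔠 = 1` when `c • 𝔠 = 𝔠`.
[cite: NeukirchANT1999, Ch. I §9 (before (9.1))] -/
theorem isCoprime_smul_iff (c : K ≃ₐ[ℚ] K) {I 𝔠 : Ideal (𝓞 K)} (h𝔠 : c • 𝔠 = 𝔠) : IsCoprime (c • I) 𝔠 ↔ IsCoprime I 𝔠 := by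
  have key : ∀ (d : K ≃ₐ[ℚ] K) (J : Ideal (𝓞 K)), d • 𝔠 = 𝔠 → IsCoprime J 𝔠 → IsCoprime (d • J) 𝔠 := by
    intro d J hd hJ
    rw [Ideal.isCoprime_iff_sup_eq] at hJ ⊢
    have h := congrArg (fun L : Ideal (𝓞 K) ↦ d • L) hJ
    simp only [Ideal.smul_sup, hd, smul_top_ideal] at h
    exact h
  refine ⟨fun h ↦ ?_, key c I h𝔠⟩
  have h𝔠' : c⁻¹ • 𝔠 = 𝔠 := by rw [inv_smul_eq_iff, h𝔠]
  simpa only [inv_smul_smul] using key c⁻¹ (c • I) h𝔠' h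

/-- ★ **(D-conj) THE REINDEXING**: under CM-reality off `𝔪` and for a `c`-stable proper modulus `𝔠 ⊆ 𝔪`, the depleted Dirichlet series with
coefficients `\overline{ψ(𝔟)}·F(N𝔟)` and `ψ(𝔟)·F(N𝔟)` coincide (as unconditional sums over all ideals, `0` off the ideals prime to `𝔠`):
substitute `𝔟 ↦ c • 𝔟` (a bijection of the ideals preserving `N` and coprimality to `𝔠`) and use `ψ(c • 𝔟) = \overline{ψ(𝔟)}`. With
`F m = χ(m)·m^{−s}` this identifies Kato's `L_{𝔠}(ψ̄, χ∘N, s)` with the Mazur–Tate side's `L_{𝔠}(ψ, χ∘N, s)`.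
[cite: SilvermanATAEC1994, Ch. II Ex. 2.30] [cite: Kato2004Asterisque, Prop. 15.9 and (15.9.1)] -/
theorem tsum_conj_idealPow_eq_tsum_idealPow (c : K ≃ₐ[ℚ] K) {𝔪 𝔠 : Ideal (𝓞 K)} {ψ : HeightOneSpectrum (𝓞 K) → ℂ}
    (hψc : ∀ w : HeightOneSpectrum (𝓞 K), ¬ 𝔪 ≤ w.asIdeal → ψ (c • w) = conj (ψ w)) (h𝔠c : c • 𝔠 = 𝔠) (h𝔠𝔪 : 𝔠 ≤ 𝔪) (h𝔠 : 𝔠 ≠ ⊤)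
    (F : ℕ → ℂ) :
    ∑' I : Ideal (𝓞 K), (if IsCoprime I 𝔠 then conj (idealPow K ψ I) * F (Ideal.absNorm I) else 0) =
      ∑' I : Ideal (𝓞 K), (if IsCoprime I 𝔠 then idealPow K ψ I * F (Ideal.absNorm I) else 0) := by
  rw [← Equiv.tsum_eq (MulAction.toPerm c)]
  refine tsum_congr fun I ↦ ?_
  rw [MulAction.toPerm_apply, isCoprime_smul_iff c h𝔠c]
  split_ifs with hI
  · have hI0 : I ≠ ⊥ := by
      rintro rfl
      have h := Ideal.isCoprime_iff_sup_eq.mp hI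
      rw [bot_sup_eq] at h
      exact h𝔠 h
    have hI𝔪 : IsCoprime I 𝔪 := by
      refine Ideal.isCoprime_iff_sup_eq.mpr (top_le_iff.mp ?_)
      rw [← Ideal.isCoprime_iff_sup_eq.mp hI]
      exact sup_le_sup_left h𝔠𝔪 I
    rw [idealPow_smul_eq_conj c hψc hI0 hI𝔪, Literature.NumberTheory.DiophantineGeometry.Catalan.absNorm_smul, Complex.conj_conj]
  · rfl

/-! ## Two-sided CM-reality (the correct premise when `𝔪` is not `c`-stable: `w ∤ 𝔪` AND `c • w ∤ 𝔪`, as in `isHeckeConjEquivariant_heckeOfGross`) -/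

/-- **CM-reality on ideals, two-sided form**: if `ψ(c • w) = \overline{ψ(w)}` for the primes `w` with `w ∤ 𝔪` and `c • w ∤ 𝔪`, then
`ψ(c • 𝔟) = \overline{ψ(𝔟)}` for every nonzero `𝔟` with `𝔟` and `c • 𝔟` prime to `𝔪`. [cite: SilvermanATAEC1994, Ch. II Ex. 2.30] -/
theorem idealPow_smul_eq_conj₂ (c : K ≃ₐ[ℚ] K) {𝔪 : Ideal (𝓞 K)} {ψ : HeightOneSpectrum (𝓞 K) → ℂ}
    (hψc : ∀ w : HeightOneSpectrum (𝓞 K), ¬ 𝔪 ≤ w.asIdeal → ¬ 𝔪 ≤ (c • w).asIdeal → ψ (c • w) = conj (ψ w)) {I : Ideal (𝓞 K)} (hI : I ≠ ⊥)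
    (hI𝔪 : IsCoprime I 𝔪) (hcI𝔪 : IsCoprime (c • I) 𝔪) :
    idealPow K ψ (c • I) = conj (idealPow K ψ I) := by
  rw [idealPow_smul c ψ hI]
  have hcong : idealPow K (fun w ↦ ψ (c • w)) I = idealPow K (fun w ↦ conj (ψ w)) I := by
    unfold idealPow
    refine finprod_congr fun v ↦ ?_
    by_cases hc : (Associates.mk v.asIdeal).count (Associates.mk I).factors = 0
    · rw [hc, pow_zero, pow_zero]
    · have hdvd : v.asIdeal ∣ I := (Associates.count_ne_zero_iff_dvd hI v.irreducible).mp hc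
      have hv : ¬ 𝔪 ≤ v.asIdeal := fun hv ↦ by
        have hle : I ⊔ 𝔪 ≤ v.asIdeal := sup_le (Ideal.le_of_dvd hdvd) hv
        rw [Ideal.isCoprime_iff_sup_eq.mp hI𝔪, top_le_iff] at hle
        exact v.isPrime.ne_top hle
      have hcv : ¬ 𝔪 ≤ (c • v).asIdeal := fun hv' ↦ by
        have hdvd' : (c • v).asIdeal ∣ c • I := by
          rw [HeightOneSpectrum.smul_asIdeal, Ideal.dvd_iff_le, Ideal.pointwise_smul_le_pointwise_smul_iff]
          exact Ideal.le_of_dvd hdvd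
        have hle : c • I ⊔ 𝔪 ≤ (c • v).asIdeal := sup_le (Ideal.le_of_dvd hdvd') hv'
        rw [Ideal.isCoprime_iff_sup_eq.mp hcI𝔪, top_le_iff] at hle
        exact (c • v).isPrime.ne_top hle
      simp only [hψc v hv hcv]
  rw [hcong]
  symm
  unfold idealPow
  rw [map_finprod _ (mulSupport_idealPow_finite ψ hI)]
  exact finprod_congr fun v ↦ by rw [map_pow]

/-- ★ **(D-conj) THE REINDEXING, two-sided premise**: as `tsum_conj_idealPow_eq_tsum_idealPow`, but CM-reality is only required at the primes `w`
with `w ∤ 𝔪` and `c • w ∤ 𝔪` (for a `c`-stable `𝔠 ⊆ 𝔪` every `𝔟` prime to `𝔠` has `𝔟, c • 𝔟` prime to `𝔪`).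
[cite: SilvermanATAEC1994, Ch. II Ex. 2.30] [cite: Kato2004Asterisque, Prop. 15.9 and (15.9.1)] -/
theorem tsum_conj_idealPow_eq_tsum_idealPow₂ (c : K ≃ₐ[ℚ] K) {𝔪 𝔠 : Ideal (𝓞 K)} {ψ : HeightOneSpectrum (𝓞 K) → ℂ}
    (hψc : ∀ w : HeightOneSpectrum (𝓞 K), ¬ 𝔪 ≤ w.asIdeal → ¬ 𝔪 ≤ (c • w).asIdeal → ψ (c • w) = conj (ψ w)) (h𝔠c : c • 𝔠 = 𝔠) (h𝔠𝔪 : 𝔠 ≤ 𝔪)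
    (h𝔠 : 𝔠 ≠ ⊤) (F : ℕ → ℂ) :
    ∑' I : Ideal (𝓞 K), (if IsCoprime I 𝔠 then conj (idealPow K ψ I) * F (Ideal.absNorm I) else 0) =
      ∑' I : Ideal (𝓞 K), (if IsCoprime I 𝔠 then idealPow K ψ I * F (Ideal.absNorm I) else 0) := by
  rw [← Equiv.tsum_eq (MulAction.toPerm c)]
  refine tsum_congr fun I ↦ ?_
  rw [MulAction.toPerm_apply, isCoprime_smul_iff c h𝔠c]
  split_ifs with hI
  · have hI0 : I ≠ ⊥ := by
      rintro rfl
      have h := Ideal.isCoprime_iff_sup_eq.mp hI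
      rw [bot_sup_eq] at h
      exact h𝔠 h
    have hup : ∀ {J : Ideal (𝓞 K)}, IsCoprime J 𝔠 → IsCoprime J 𝔪 := fun {J} hJ ↦ by
      refine Ideal.isCoprime_iff_sup_eq.mpr (top_le_iff.mp ?_)
      rw [← Ideal.isCoprime_iff_sup_eq.mp hJ]
      exact sup_le_sup_left h𝔠𝔪 J
    rw [idealPow_smul_eq_conj₂ c hψc hI0 (hup hI) (hup ((isCoprime_smul_iff c h𝔠c).mpr hI)),
      Literature.NumberTheory.DiophantineGeometry.Catalan.absNorm_smul, Complex.conj_conj]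
  · rfl

end Summit.BirchSwinnertonDyer.BirchSwinnertonDyer.Theorems.SmallImageRttF1Bridge

end
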